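import Summits.QuantumFields.YangMills.Theorems.ColdStartUniversalityLatticeLangevinSplice
import Summits.QuantumFields.YangMills.Theorems.ColdStartUniversalityLatticeLangevinSampling
import Summits.QuantumFields.YangMills.Theorems.ColdStartUniversalityLatticeLangevinSampleShift
import Summits.QuantumFields.YangMills.Theorems.ColdStartUniversalityLatticeLangevinWellPosed
import HarnessLib

/-!
# Route `ColdStartUniversality` (rung input (M), crux K_A1 stmt-QuantumFields-24809): preparations for the cocycle —
# drift continuity, Riemann–Itô sums up to a time, stopped u.c.p. limits, sums of limits in probability

Helper file (seat `ym-line-csu-p1`, g4); generic lemmas used by the splicing proof of the flow (cocycle) property: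

* `continuous_drift_entry` — the SZZ drift entries are continuous on `SU(2)^E` (through the tame modification of
  `exists_truncatedCoefficients`, which agrees with the SZZ system on the group);
* `sample_integral_eq_of_eqOn` — integrands agreeing on `[0, t]` have equal dyadic Riemann–Itô sums on `[0, t]`;
* `tendstoUCP_min` — u.c.p. convergence is preserved by stopping at a deterministic time;
* `tendsto_measure_sub`, `tendsto_measure_sum` — convergence in probability is preserved by differences and finite sums;
* `tendsto_measure_of_ae_eq` — and by changing the limit on a null set.

No definition, no sorry.  RECORD-rung R3 plumbing; nothing here bears on the mass gap.
-/

set_option autoImplicit false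

noncomputable section

namespace Summit.QuantumFields.YangMills.Theorems.ColdStartUniversality

open MeasureTheory ProbabilityTheory Filter Topology Finset
open scoped NNReal ENNReal BigOperators
open Literature Literature.Probability.Process Literature.MathematicalPhysics.QuantumFieldTheory
open Literature.MathematicalPhysics.QuantumLattice (fundamentalRep fundamentalLatticeRep continuous_fundamentalRep)

/-! ## Drift continuity -/

/-- The SZZ drift entry `(b_e(ρ ∘ V))_{ij}` is a continuous function of the configuration `V ∈ SU(2)^E` (it agrees there
with the tame Lipschitz modification of `exists_truncatedCoefficients`). [folklore] -/
theorem continuous_drift_entry {L : ℕ} [NeZero L] (β : ℝ) (e : Edge 3 L) (i j : Fin 2) :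
    Continuous (fun V : GaugeConfig 3 L (Matrix.specialUnitaryGroup (Fin 2) ℂ) =>
      (latticeLangevinDynamics (fundamentalLatticeRep 2) β).drift (matrixConfig (fundamentalRep (Fin 2)) V) e i j) := by
  obtain ⟨S, ⟨⟨K, hK⟩, -⟩, -, hAgree⟩ := exists_truncatedCoefficients L β
  have hsum0 : ∀ Q Q' : MatrixConfig 3 L 2, 0 ≤ ∑ e', hsForm 2 (Q e' - Q' e') (Q e' - Q' e') := fun Q Q' =>
    Finset.sum_nonneg fun _ _ => hsForm_self_nonneg _
  have hSd' : ∀ (Q Q' : MatrixConfig 3 L 2),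
      hsForm 2 (S.drift Q e - S.drift Q' e) (S.drift Q e - S.drift Q' e) ≤
        max K 0 * ∑ e', hsForm 2 (Q e' - Q' e') (Q e' - Q' e') := fun Q Q' =>
    ((hK Q Q' e).1).trans (mul_le_mul_of_nonneg_right (le_max_left _ _) (hsum0 Q Q'))
  have hSdc : Continuous fun Q : MatrixConfig 3 L 2 => S.drift Q e := continuous_of_hsForm_lipschitz hSd'
  have hQ : Continuous fun V : GaugeConfig 3 L (Matrix.specialUnitaryGroup (Fin 2) ℂ) =>
      matrixConfig (fundamentalRep (Fin 2)) V :=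
    continuous_pi fun e' => (continuous_fundamentalRep (Fin 2)).comp (continuous_apply e')
  have heq : (fun V : GaugeConfig 3 L (Matrix.specialUnitaryGroup (Fin 2) ℂ) =>
      (latticeLangevinDynamics (fundamentalLatticeRep 2) β).drift (matrixConfig (fundamentalRep (Fin 2)) V) e i j) =
      fun V => S.drift (matrixConfig (fundamentalRep (Fin 2)) V) e i j := by
    funext V
    rw [(hAgree V e).1]
  rw [heq]
  exact ((continuous_apply j).comp (continuous_apply i)).comp (hSdc.comp hQ)

/-! ## Riemann–Itô sums up to a time -/

section Generic

variable {Ω : Type*} {mΩ : MeasurableSpace Ω} {P : Measure Ω} {𝓕 : Filtration ℝ≥0 mΩ}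

/-- **Integrands agreeing on `[0, t]` have equal dyadic Riemann–Itô sums on `[0, t]`** (the sum at time `u` only reads
the integrand at grid points `< u`). [folklore] -/
theorem sample_integral_eq_of_eqOn {σ σ' : ℝ≥0 → Ω → ℝ} (hσ : Adapted 𝓕 σ) (hσ' : Adapted 𝓕 σ')
    (B : ℝ≥0 → Ω → ℝ) (ω : Ω) {t : ℝ≥0} (h : ∀ u, u ≤ t → σ u ω = σ' u ω) (m : ℕ) {u : ℝ≥0} (hu : u ≤ t) :
    (SimpleProcess.sample σ hσ m).integral B u ω = (SimpleProcess.sample σ' hσ' m).integral B u ω := by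
  rw [SimpleProcess.integral_apply_eq_sum_summand, SimpleProcess.integral_apply_eq_sum_summand,
    SimpleProcess.sample_times, SimpleProcess.sample_times]
  refine Finset.sum_congr rfl fun k hk => ?_
  have hkN : k < m * 2 ^ m := by simpa [length_dyadicTimes] using mem_range.1 hk
  simp only [SimpleProcess.summand_apply, SimpleProcess.sample_value,
    SimpleProcess.sample_time σ hσ m (show k < m * 2 ^ m + 1 by omega),
    SimpleProcess.sample_time σ' hσ' m (show k < m * 2 ^ m + 1 by omega),
    SimpleProcess.sample_time σ hσ m (show k + 1 < m * 2 ^ m + 1 by omega),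
    SimpleProcess.sample_time σ' hσ' m (show k + 1 < m * 2 ^ m + 1 by omega)]
  by_cases hku : ((k : ℕ) : ℝ≥0) / 2 ^ m < u
  · rw [h _ (hku.le.trans hu)]
  · -- the increment vanishes
    have h1 : min u (((k : ℕ) : ℝ≥0) / 2 ^ m) = u := min_eq_left (le_of_not_gt hku)
    have h2 : min u (((k + 1 : ℕ) : ℝ≥0) / 2 ^ m) = u := min_eq_left ((le_of_not_gt hku).trans
      (div_le_div_of_nonneg_right (by exact_mod_cast Nat.le_succ k) (pow_pos two_pos m).le))
    rw [h1, h2, sub_self, mul_zero, mul_zero]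

/-- **Stopping preserves u.c.p. convergence** (deterministic time). [folklore] -/
theorem tendstoUCP_min {A : ℕ → ℝ≥0 → Ω → ℝ} {K : ℝ≥0 → Ω → ℝ} (h : TendstoUCP A K P) (t : ℝ≥0) :
    TendstoUCP (fun m u => A m (min u t)) (fun u => K (min u t)) P := by
  intro T ε hε
  refine tendsto_of_tendsto_of_tendsto_of_le_of_le tendsto_const_nhds (h T ε hε) (fun n => zero_le) fun n => ?_
  exact measure_mono fun ω ⟨u, hu, hε'⟩ => ⟨min u t, (min_le_left _ _).trans hu, hε'⟩

/-- **Convergence in probability of differences.** [folklore] -/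
theorem tendsto_measure_sub {a b : ℕ → Ω → ℝ} {Z Z' : Ω → ℝ}
    (ha : ∀ ε : ℝ, 0 < ε → Tendsto (fun n => P {ω | ε ≤ |a n ω - Z ω|}) atTop (𝓝 0))
    (hb : ∀ ε : ℝ, 0 < ε → Tendsto (fun n => P {ω | ε ≤ |b n ω - Z' ω|}) atTop (𝓝 0)) :
    ∀ ε : ℝ, 0 < ε → Tendsto (fun n => P {ω | ε ≤ |(a n ω - b n ω) - (Z ω - Z' ω)|}) atTop (𝓝 0) := by
  intro ε hε
  have hle : ∀ n, P {ω | ε ≤ |(a n ω - b n ω) - (Z ω - Z' ω)|} ≤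
      P {ω | ε / 2 ≤ |a n ω - Z ω|} + P {ω | ε / 2 ≤ |b n ω - Z' ω|} := by
    intro n
    refine (measure_mono fun ω hω => ?_).trans (measure_union_le _ _)
    by_contra hcon
    simp only [Set.mem_union, Set.mem_setOf_eq, not_or, not_le] at hcon
    have h1 : |(a n ω - b n ω) - (Z ω - Z' ω)| ≤ |a n ω - Z ω| + |b n ω - Z' ω| := by
      have := abs_sub (a n ω - Z ω) (b n ω - Z' ω)
      rwa [show a n ω - Z ω - (b n ω - Z' ω) = (a n ω - b n ω) - (Z ω - Z' ω) by ring] at this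
    have h2 : ε ≤ |(a n ω - b n ω) - (Z ω - Z' ω)| := hω
    linarith [hcon.1, hcon.2]
  have hlim : Tendsto (fun n => P {ω | ε / 2 ≤ |a n ω - Z ω|} + P {ω | ε / 2 ≤ |b n ω - Z' ω|}) atTop (𝓝 0) := by
    simpa using (ha _ (half_pos hε)).add (hb _ (half_pos hε))
  exact tendsto_of_tendsto_of_tendsto_of_le_of_le tendsto_const_nhds hlim (fun n => zero_le) hle

/-- **Convergence in probability of finite sums.** [folklore] -/
theorem tendsto_measure_sum {ι : Type*} (S : Finset ι) {a : ι → ℕ → Ω → ℝ} {Z : ι → Ω → ℝ}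
    (ha : ∀ i ∈ S, ∀ ε : ℝ, 0 < ε → Tendsto (fun n => P {ω | ε ≤ |a i n ω - Z i ω|}) atTop (𝓝 0)) :
    ∀ ε : ℝ, 0 < ε → Tendsto (fun n => P {ω | ε ≤ |∑ i ∈ S, a i n ω - ∑ i ∈ S, Z i ω|}) atTop (𝓝 0) := by
  classical
  induction S using Finset.induction_on with
  | empty =>
    intro ε hε
    have : ∀ n, P {ω | ε ≤ |∑ i ∈ (∅ : Finset ι), a i n ω - ∑ i ∈ (∅ : Finset ι), Z i ω|} = 0 := fun n => by
      have : {ω | ε ≤ |∑ i ∈ (∅ : Finset ι), a i n ω - ∑ i ∈ (∅ : Finset ι), Z i ω|} = ∅ := by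
        ext ω; simp [not_le.2 hε]
      rw [this, measure_empty]
    simp only [this]
    exact tendsto_const_nhds
  | insert i S hi ih =>
    intro ε hε
    have h1 := ha i (Finset.mem_insert_self i S)
    have h2 := ih (fun j hj => ha j (Finset.mem_insert_of_mem hj))
    -- `Σ_{insert} = a i + Σ_S`: a difference of a sum with `b := -Σ`
    have h3 := tendsto_measure_sub h1 (a := a i) (Z := Z i) (b := fun n ω => -∑ j ∈ S, a j n ω)
      (Z' := fun ω => -∑ j ∈ S, Z j ω) (fun ε' hε' => by
        have h := h2 ε' hε'
        refine h.congr' (Eventually.of_forall fun n => ?_)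
        congr 1
        ext ω
        simp only [Set.mem_setOf_eq]
        rw [show -∑ j ∈ S, a j n ω - -∑ j ∈ S, Z j ω = -(∑ j ∈ S, a j n ω - ∑ j ∈ S, Z j ω) by ring, abs_neg])
      ε hε
    refine h3.congr' (Eventually.of_forall fun n => ?_)
    congr 1
    ext ω
    simp only [Set.mem_setOf_eq, Finset.sum_insert hi]
    rw [show a i n ω - -∑ j ∈ S, a j n ω - (Z i ω - -∑ j ∈ S, Z j ω) =
      a i n ω + ∑ j ∈ S, a j n ω - (Z i ω + ∑ j ∈ S, Z j ω) by ring]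

/-- Convergence in probability is insensitive to changing the limit on a null set. [folklore] -/
theorem tendsto_measure_of_ae_eq {a : ℕ → Ω → ℝ} {Z Z' : Ω → ℝ}
    (ha : ∀ ε : ℝ, 0 < ε → Tendsto (fun n => P {ω | ε ≤ |a n ω - Z ω|}) atTop (𝓝 0))
    (hZ : ∀ᵐ ω ∂P, Z ω = Z' ω) :
    ∀ ε : ℝ, 0 < ε → Tendsto (fun n => P {ω | ε ≤ |a n ω - Z' ω|}) atTop (𝓝 0) := by
  intro ε hε
  refine (ha ε hε).congr' (Eventually.of_forall fun n => measure_congr ?_)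
  filter_upwards [hZ] with ω hω
  show (ε ≤ |a n ω - Z ω|) = (ε ≤ |a n ω - Z' ω|)
  rw [hω]

/-- Convergence in probability at a fixed time from u.c.p. convergence, for the difference of the values at two times.
[folklore] -/
theorem tendsto_measure_sub_of_tendstoUCP {A : ℕ → ℝ≥0 → Ω → ℝ} {K : ℝ≥0 → Ω → ℝ} (h : TendstoUCP A K P)
    (t t' : ℝ≥0) : ∀ ε : ℝ, 0 < ε →
      Tendsto (fun n => P {ω | ε ≤ |(A n t ω - A n t' ω) - (K t ω - K t' ω)|}) atTop (𝓝 0) :=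
  tendsto_measure_sub (fun _ hε => tendsto_measure_of_tendstoUCP h t hε)
    (fun _ hε => tendsto_measure_of_tendstoUCP h t' hε)

end Generic

end Summit.QuantumFields.YangMills.Theorems.ColdStartUniversality

end
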